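import Mathlib
import Summits.ValiantsHypothesis.ValiantsHypothesis.Theses.FermionizationDimension
import Summits.ValiantsHypothesis.ValiantsHypothesis.Theorems.DetqpThesis.Negative.NotQPBoundedOfExp
import Summits.ValiantsHypothesis.ValiantsHypothesis.Theorems.ClassTransfer.Negative.FlatteningKernel
import Summits.ValiantsHypothesis.ValiantsHypothesis.Theorems.ClassTransfer.Negative.KeyKernel

/-!
# Crux `ClassTransfer` (stmt-ValiantsHypothesis-7287), negative side —
# the crux PREDICTS that every fermionant `Fer_k = Σ_σ sgn(σ) k^{c(σ)} x^σ`, `k ≥ 2`, is outside `VP`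

Lead prover (gen 1) of line `registered`.  The fermionant (Chandrasekharan–Wiese;
MertensMoore2013) `Fer_k(X) = (-1)^n Σ_σ (-k)^{c(σ)} ∏ x_{σ(i),i} = Σ_σ sgn(σ) k^{c(σ)} x^σ`
(`c(σ)` = number of cycles, `Fer_1 = det`) is the generalized-matrix-function family of the CLASS
FUNCTION `sgn · k^{c}`; we write `k^{c(σ)}` cycle-free as the number of `k`-colourings constant
on the cycles, `#{f : [n] → [k] | f ∘ σ = f}`.  MertensMoore2013 prove `Fer_k` `#P`-hard under
Turing reductions for `k ≥ 3` and `⊕P`-hard for `k = 2`; in Valiant's model over `ℂ` the status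
of `Fer_2 = (-1)^n per_{-2}` is open, and the cover-balance tests of `Negative/CoverBalance.lean`
are silent on it (`K_r(sgn · k^c) = ± Σ_δ sgn(δ) k^{c(δ)} = ± k(k-1)⋯(k-m+1) = 0` for `m > k`).
The crux nevertheless decides the question:

* `centralBinom_le_finrank_of_colourFix` — **a commutative twisting realisation of
  `σ ↦ k^{c(σ)}` (`k ≥ 2`) on `S_{4t}` has dimension `≥ C(2t, t)`**: flatten across two blocks of
  size `2t` with the block permutations `τ(α, γ)` of `Negative/TwoCycleWeight.lean`; the
  flattening matrix is the colouring kernel `#{h : [2t] → [k] | h ∘ α = h ∘ γ}` (`= k^{c(γ⁻¹α)}`),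
  and on a transversal `π_S` (the `t`-subset `S` sent onto the first `t` points) it is positive
  definite — its Gram expansion `Σ_h Σ_c |Σ_{S : h ∘ π_S = c} v_S|²` contains, at the two-valued
  colouring `h₀ = [· < t]` with `h₀ ∘ π_S = 1_S`, every `|v_S|²` — so
  `card_le_finrank_of_flattening` applies (`sum_conj_mul_indicator_key`, `exists_perm_mem_iff_lt`).
* `colourFix_isClassFunction` — `sgn · k^{c}` is a class function.
* `not_classTransfer_of_isVPFamily_fermionant`, `not_isVPFamily_fermionant_of_classTransfer` —
  **`ClassTransfer ⇒ Fer_k ∉ VP_ℂ` for every `k ≥ 2`** (the crux would realise `k^{c}` in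
  dimension `≤ 2^{(log₂ 4t + c)^c} < 2^t < C(2t, t)`).  This consequence is NOT known to follow
  from `VP ≠ VNP`; it is the crux's sharpest open test: settle the algebraic complexity of
  `Fer_2 = Σ_σ sgn(σ) 2^{c(σ)} x^σ`.

No definitions (the colouring count is inlined).  References: MertensMoore2013; flattening
bounds and Gram positivity are folklore. [folklore]
-/

set_option linter.dupNamespace false

noncomputable section

namespace Summit.ValiantsHypothesis.ValiantsHypothesis.Theorems.ClassTransfer.Negative

open Equiv Finset

/-! ## Flattening the colouring count across two blocks -/

/-- **Block flattening of the colouring count.**  If `(R, u, ℓ)` realises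
`σ ↦ #{f : [4t] → [k+2] | f ∘ σ = f}` (`= (k+2)^{c(σ)}`) on `S_{4t}`, then `dim R ≥ C(2t, t)`:
for `α, γ ∈ S_{2t}` the block permutation `τ(α, γ)` (`inl i ↦ inr (α i)`,
`inr j ↦ inl (γ⁻¹ j)`) fixes exactly the colourings `(h ∘ α, h)` with `h ∘ α = h ∘ γ`, its
realising product splits as `P α · Q γ`, and on a transversal `π_S` (`S` a `t`-subset sent onto
the first `t` points) the colouring kernel `#{h | h ∘ π_S = h ∘ π_T}` is positive definite.
[folklore] -/
theorem centralBinom_le_finrank_of_colourFix {t k : ℕ} {R : Type*} [CommRing R] [Algebra ℂ R]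
    [Module.Finite ℂ R] (u : Fin ((t + t) + (t + t)) → Fin ((t + t) + (t + t)) → R)
    (ℓ : R →ₗ[ℂ] ℂ)
    (hu : ∀ σ : Perm (Fin ((t + t) + (t + t))), ℓ (∏ x, u (σ x) x) =
      ((univ.filter fun f : Fin ((t + t) + (t + t)) → Fin (k + 2) =>
        ∀ x, f (σ x) = f x).card : ℂ)) :
    Nat.centralBinom t ≤ Module.finrank ℂ R := by
  classical
  -- two blocks of size `m = 2t`
  generalize hm : t + t = m at u hu
  set e : Fin m ⊕ Fin m ≃ Fin (m + m) := finSumFinEquiv with he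
  set τ : Perm (Fin m) → Perm (Fin m) → Perm (Fin (m + m)) := fun α γ =>
    e.permCongr ((Equiv.sumCongr α γ.symm).trans (Equiv.sumComm (Fin m) (Fin m))) with hτ
  have hinl : ∀ (α γ : Perm (Fin m)) (i : Fin m), τ α γ (e (Sum.inl i)) = e (Sum.inr (α i)) := by
    intro α γ i
    simp [hτ, Equiv.permCongr_apply]
  have hinr : ∀ (α γ : Perm (Fin m)) (j : Fin m),
      τ α γ (e (Sum.inr j)) = e (Sum.inl (γ.symm j)) := by
    intro α γ j
    simp [hτ, Equiv.permCongr_apply]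
  set P : Perm (Fin m) → R := fun α => ∏ i : Fin m, u (e (Sum.inr (α i))) (e (Sum.inl i)) with hP
  set Q : Perm (Fin m) → R := fun γ => ∏ j : Fin m, u (e (Sum.inl (γ.symm j))) (e (Sum.inr j))
    with hQ
  -- the realising product splits along the two blocks
  have hprod : ∀ α γ : Perm (Fin m), ∏ x, u (τ α γ x) x = P α * Q γ := by
    intro α γ
    rw [← Fintype.prod_equiv e (fun y => u (τ α γ (e y)) (e y)) (fun x => u (τ α γ x) x)
      (fun y => rfl), Fintype.prod_sum_type]
    simp only [hinl, hinr, hP, hQ]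
  -- the colourings fixed by a block permutation
  have hcount : ∀ α γ : Perm (Fin m),
      (univ.filter fun f : Fin (m + m) → Fin (k + 2) => ∀ x, f (τ α γ x) = f x).card =
        (univ.filter fun h : Fin m → Fin (k + 2) =>
          (fun i => h (α i)) = fun i => h (γ i)).card := by
    intro α γ
    refine Finset.card_bij (fun f _ => fun j => f (e (Sum.inr j))) ?_ ?_ ?_
    · intro f hf
      simp only [Finset.mem_filter, Finset.mem_univ, true_and] at hf ⊢
      funext i
      have h1 := hf (e (Sum.inl i))
      rw [hinl] at h1
      have h2 := hf (e (Sum.inr (γ i)))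
      rw [hinr, Equiv.symm_apply_apply] at h2
      exact h1.trans h2
    · intro f hf g hg hfg
      funext x
      obtain ⟨y, rfl⟩ := e.surjective x
      rcases y with i | j
      · have hf1 := (Finset.mem_filter.1 hf).2 (e (Sum.inl i))
        rw [hinl] at hf1
        have hg1 := (Finset.mem_filter.1 hg).2 (e (Sum.inl i))
        rw [hinl] at hg1
        have h3 : f (e (Sum.inr (α i))) = g (e (Sum.inr (α i))) := congrFun hfg (α i)
        rw [← hf1, ← hg1, h3]
      · exact congrFun hfg j
    · intro h hh
      have hh' : ∀ i, h (α i) = h (γ i) := fun i => congrFun (Finset.mem_filter.1 hh).2 i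
      refine ⟨fun x => Sum.elim (fun i => h (α i)) h (e.symm x), ?_, ?_⟩
      · simp only [Finset.mem_filter, Finset.mem_univ, true_and]
        intro x
        obtain ⟨y, rfl⟩ := e.surjective x
        rcases y with i | j
        · rw [hinl]
          simp
        · rw [hinr]
          simp only [Equiv.symm_apply_apply, Sum.elim_inl, Sum.elim_inr]
          rw [hh', Equiv.apply_symm_apply]
      · funext j
        simp
  -- a transversal: `π S` carries the `t`-subset `S` onto the first `t` points
  have hrep : ∀ S : {S : Finset (Fin m) // S.card = t}, ∃ π : Perm (Fin m),
      ∀ i : Fin m, i ∈ S.1 ↔ ((π i : Fin m) : ℕ) < t := fun S => exists_perm_mem_iff_lt S.1 S.2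
  choose π hπ using hrep
  -- the index set has `C(2t, t)` elements
  have hcardι : Fintype.card {S : Finset (Fin m) // S.card = t} = Nat.centralBinom t := by
    rw [Fintype.card_subtype, Nat.centralBinom_eq_two_mul_choose]
    have hpc : (univ.filter fun S : Finset (Fin m) => S.card = t) = Finset.powersetCard t univ := by
      ext S
      simp [Finset.mem_powersetCard]
    rw [hpc, Finset.card_powersetCard, Finset.card_univ, Fintype.card_fin, ← hm, two_mul]
  -- the flattening matrix: the colouring kernel on the transversal
  set M : Matrix {S : Finset (Fin m) // S.card = t} {S : Finset (Fin m) // S.card = t} ℂ :=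
    Matrix.of fun S T => ∑ h : Fin m → Fin (k + 2),
      (if (fun i => h (π S i)) = (fun i => h (π T i)) then (1 : ℂ) else 0) with hMdef
  have hMST : ∀ S T, ℓ (P (π S) * Q (π T)) = M S T := by
    intro S T
    rw [hMdef, Matrix.of_apply, ← hprod, hu, hcount, Finset.card_filter]
    push_cast
    rfl
  rw [← hcardι]
  refine card_le_finrank_of_flattening ℓ (fun S => P (π S)) (fun T => Q (π T)) M hMST ?_
  -- positivity: `M v = 0` forces `v = 0`
  intro v hv
  -- the quadratic form, colouring by colouring
  have hq : ∑ h : Fin m → Fin (k + 2), ∑ S, ∑ T, (starRingEnd ℂ) (v S) *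
      (if (fun i => h (π S i)) = (fun i => h (π T i)) then (1 : ℂ) else 0) * v T = 0 := by
    have h1 : ∑ h : Fin m → Fin (k + 2), ∑ S, ∑ T, (starRingEnd ℂ) (v S) *
        (if (fun i => h (π S i)) = (fun i => h (π T i)) then (1 : ℂ) else 0) * v T =
        ∑ S, (starRingEnd ℂ) (v S) * (M.mulVec v) S := by
      simp only [Matrix.mulVec, dotProduct, hMdef, Matrix.of_apply, Finset.sum_mul,
        Finset.mul_sum]
      rw [Finset.sum_comm]
      refine Finset.sum_congr rfl fun S _ => ?_
      rw [Finset.sum_comm]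
      refine Finset.sum_congr rfl fun T _ => Finset.sum_congr rfl fun h _ => ?_
      ring
    rw [h1, hv]
    simp
  -- each colouring contributes a nonnegative real
  have hnonneg : ∀ h ∈ (univ : Finset (Fin m → Fin (k + 2))),
      0 ≤ (∑ S, ∑ T, (starRingEnd ℂ) (v S) *
        (if (fun i => h (π S i)) = (fun i => h (π T i)) then (1 : ℂ) else 0) * v T).re := by
    intro h _
    rw [sum_conj_mul_indicator_key (fun S => fun i => h (π S i)) v, Complex.re_sum]
    refine Finset.sum_nonneg fun c _ => ?_
    rw [← Complex.normSq_eq_conj_mul_self, Complex.ofReal_re]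
    exact Complex.normSq_nonneg _
  have hre : ∑ h : Fin m → Fin (k + 2), (∑ S, ∑ T, (starRingEnd ℂ) (v S) *
      (if (fun i => h (π S i)) = (fun i => h (π T i)) then (1 : ℂ) else 0) * v T).re = 0 := by
    have := congrArg Complex.re hq
    rwa [Complex.re_sum, Complex.zero_re] at this
  -- the two-valued colouring `h₀ = [· < t]` separates the indices: `h₀ ∘ π_S = 1_S`
  set h₀ : Fin m → Fin (k + 2) := fun j => if (j : ℕ) < t then 1 else 0 with hh₀
  have hkey : ∀ S : {S : Finset (Fin m) // S.card = t},
      (fun i => h₀ (π S i)) = fun i => if i ∈ S.1 then (1 : Fin (k + 2)) else 0 := by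
    intro S
    funext i
    simp only [hh₀]
    exact if_congr (hπ S i).symm rfl rfl
  have hkey_inj : ∀ S T : {S : Finset (Fin m) // S.card = t},
      (fun i => h₀ (π S i)) = (fun i => h₀ (π T i)) → S = T := by
    intro S T hST
    rw [hkey S, hkey T] at hST
    apply Subtype.ext
    ext i
    have hi := congrFun hST i
    have h10 : (1 : Fin (k + 2)) ≠ 0 := Fin.zero_lt_one.ne'
    by_cases hS : i ∈ S.1
    · by_cases hT : i ∈ T.1
      · exact ⟨fun _ => hT, fun _ => hS⟩
      · rw [if_pos hS, if_neg hT] at hi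
        exact absurd hi h10
    · by_cases hT : i ∈ T.1
      · rw [if_neg hS, if_pos hT] at hi
        exact absurd hi.symm h10
      · exact ⟨fun h => absurd h hS, fun h => absurd h hT⟩
  have hterm := (Finset.sum_eq_zero_iff_of_nonneg hnonneg).1 hre h₀ (Finset.mem_univ _)
  rw [sum_conj_mul_indicator_key (fun S => fun i => h₀ (π S i)) v, Complex.re_sum] at hterm
  have hfiber : ∀ c ∈ (univ : Finset (Fin m → Fin (k + 2))), 0 ≤ ((starRingEnd ℂ)
      (∑ a ∈ univ.filter (fun a => (fun i => h₀ (π a i)) = c), v a) *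
        (∑ a ∈ univ.filter (fun a => (fun i => h₀ (π a i)) = c), v a)).re := by
    intro c _
    rw [← Complex.normSq_eq_conj_mul_self, Complex.ofReal_re]
    exact Complex.normSq_nonneg _
  funext S₀
  have hS₀ := (Finset.sum_eq_zero_iff_of_nonneg hfiber).1 hterm (fun i => h₀ (π S₀ i))
    (Finset.mem_univ _)
  rw [← Complex.normSq_eq_conj_mul_self, Complex.ofReal_re, Complex.normSq_eq_zero] at hS₀
  have hsingle : (univ.filter fun a : {S : Finset (Fin m) // S.card = t} =>
      (fun i => h₀ (π a i)) = fun i => h₀ (π S₀ i)) = {S₀} := by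
    ext a
    simp only [Finset.mem_filter, Finset.mem_univ, true_and, Finset.mem_singleton]
    exact ⟨fun h => hkey_inj a S₀ h, fun h => by rw [h]⟩
  rw [hsingle, Finset.sum_singleton] at hS₀
  exact hS₀

/-! ## The colouring count is a class function -/

/-- `#{f : [n] → [k] | f ∘ σ = f}` is invariant under conjugation (`f ↦ f ∘ c`). [folklore] -/
theorem card_colourFix_conj {n k : ℕ} (c σ : Perm (Fin n)) :
    (univ.filter fun f : Fin n → Fin k => ∀ x, f ((c * σ * c⁻¹) x) = f x).card =
      (univ.filter fun f : Fin n → Fin k => ∀ x, f (σ x) = f x).card := by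
  classical
  conv_lhs => rw [← Finset.map_univ_equiv (Equiv.arrowCongr c (Equiv.refl (Fin k))),
    Finset.filter_map, Finset.card_map]
  congr 1
  refine Finset.filter_congr fun g _ => ?_
  simp only [Function.comp_apply, Equiv.coe_toEmbedding, Equiv.arrowCongr_apply,
    Equiv.coe_refl, Perm.mul_apply, Perm.inv_def, Equiv.symm_apply_apply]
  constructor
  · intro hx y
    have := hx (c y)
    simpa using this
  · intro hy x
    exact hy (c.symm x)

/-- The fermionant coefficient `sgn(σ) · #{f : [n] → [k+2] | f ∘ σ = f}` (`= sgn σ (k+2)^{c(σ)}`)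
is a class function on every `S_n`. [folklore] -/
theorem colourFix_isClassFunction (k n : ℕ) (σ ρ : Perm (Fin n)) (h : IsConj σ ρ) :
    ((Perm.sign σ : ℤ) : ℂ) *
        ((univ.filter fun f : Fin n → Fin (k + 2) => ∀ x, f (σ x) = f x).card : ℂ) =
      ((Perm.sign ρ : ℤ) : ℂ) *
        ((univ.filter fun f : Fin n → Fin (k + 2) => ∀ x, f (ρ x) = f x).card : ℂ) := by
  obtain ⟨c, rfl⟩ := isConj_iff.1 h
  rw [card_colourFix_conj c σ]
  congr 2
  rw [Perm.sign_mul, Perm.sign_mul, Perm.sign_inv]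
  rw [mul_comm (Perm.sign c) (Perm.sign σ), mul_assoc, Int.units_mul_self, mul_one]

/-! ## `Fer_k ∈ VP ⇒ ¬ ClassTransfer` -/

/-- Arithmetic for the endgame: some `t` has `2^{(log₂ 4t + c)^c} < C(2t, t)`. [folklore] -/
theorem exists_qpBound_lt_centralBinom (c : ℕ) :
    ∃ t : ℕ, 2 ^ ((Nat.log 2 ((t + t) + (t + t)) + c) ^ c) < Nat.centralBinom t := by
  obtain ⟨t, ht4, -, hle⟩ :=
    Summit.ValiantsHypothesis.Theorems.DetqpThesis.Negative.exists_ge_qpExp_le (c + 2) 4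
  refine ⟨t, ?_⟩
  have hlog : Nat.log 2 ((t + t) + (t + t)) = Nat.log 2 t + 2 := by
    rw [show (t + t) + (t + t) = t * 2 * 2 by ring,
      Nat.log_mul_base Nat.one_lt_two (by positivity), Nat.log_mul_base Nat.one_lt_two (by omega)]
  set B := Nat.log 2 t + (c + 2) with hB
  have hB1 : 1 ≤ B := by omega
  have hexp : (Nat.log 2 ((t + t) + (t + t)) + c) ^ c ≤ t - 1 := by
    rw [hlog, show Nat.log 2 t + 2 + c = B by omega]
    calc B ^ c ≤ B ^ (c + 2) := Nat.pow_le_pow_right hB1 (by omega)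
      _ ≤ t - 1 := hle
  -- `2^t < C(2t, t)` from `4^t < t · C(2t, t)` and `t ≤ 2^t`
  have hcb : 2 ^ t < Nat.centralBinom t := by
    have h4 := Nat.four_pow_lt_mul_centralBinom t ht4
    have ht2 : t ≤ 2 ^ t := Nat.lt_two_pow_self.le
    have h44 : (4 : ℕ) ^ t = 2 ^ t * 2 ^ t := by
      rw [← mul_pow]
      norm_num
    have hmul : t * 2 ^ t < t * Nat.centralBinom t :=
      calc t * 2 ^ t ≤ 2 ^ t * 2 ^ t := Nat.mul_le_mul_right _ ht2
        _ = 4 ^ t := h44.symm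
        _ < t * Nat.centralBinom t := h4
    exact Nat.lt_of_mul_lt_mul_left hmul
  calc 2 ^ ((Nat.log 2 ((t + t) + (t + t)) + c) ^ c) ≤ 2 ^ (t - 1) :=
        Nat.pow_le_pow_right (by norm_num) hexp
    _ ≤ 2 ^ t := Nat.pow_le_pow_right (by norm_num) (by omega)
    _ < Nat.centralBinom t := hcb

/-- **No quasi-polynomial commutative realisation of the colouring count.**  There is no
quasi-polynomially bounded `s` such that every `S_n` carries a commutative realisation
`ℓ(∏ u_{σ(i),i}) = sgn(σ) · (sgn(σ) · #{f : [n] → [k+2] | f ∘ σ = f})` of dimension `≤ s(n)`: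
at `n = 4t` the dimension is `≥ C(2t, t)` (`centralBinom_le_finrank_of_colourFix`), which beats
the bound at the gap point of `exists_qpBound_lt_centralBinom`.  (The realisation clause is the
crux's, verbatim, at the class function `sgn · (k+2)^{c}`.) [folklore] -/
theorem not_qpRealisable_colourFix (k : ℕ) :
    ¬ ∃ s : ℕ → ℕ, Literature.Computability.AlgebraicComplexity.IsQPBounded s ∧ ∀ n : ℕ,
      ∃ (R : Type) (_ : CommRing R) (_ : Algebra ℂ R) (_ : Module.Finite ℂ R)
        (u : Fin n → Fin n → R) (ℓ : R →ₗ[ℂ] ℂ), Module.finrank ℂ R ≤ s n ∧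
        ∀ σ : Equiv.Perm (Fin n), ℓ (∏ i, u (σ i) i) =
          ((Equiv.Perm.sign σ : ℤ) : ℂ) * (((Equiv.Perm.sign σ : ℤ) : ℂ) *
            ((univ.filter fun f : Fin n → Fin (k + 2) => ∀ x, f (σ x) = f x).card : ℂ)) := by
  rintro ⟨s, ⟨c, hc⟩, hreal⟩
  obtain ⟨t, hlt⟩ := exists_qpBound_lt_centralBinom c
  obtain ⟨R, _, _, _, u, ℓ, hdim, hu⟩ := hreal ((t + t) + (t + t))
  have hu' : ∀ σ : Perm (Fin ((t + t) + (t + t))), ℓ (∏ x, u (σ x) x) =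
      ((univ.filter fun f : Fin ((t + t) + (t + t)) → Fin (k + 2) =>
        ∀ x, f (σ x) = f x).card : ℂ) := by
    intro σ
    rw [hu σ, ← mul_assoc, ← Int.cast_mul, ← Units.val_mul, Int.units_mul_self]
    simp
  have hflat := centralBinom_le_finrank_of_colourFix u ℓ hu'
  have hs := hc ((t + t) + (t + t))
  omega

/-- **`Fer_{k+2} ∈ VP ⇒ ¬ ClassTransfer`**: if the fermionant family
`Fer_{k+2, n} = Σ_σ sgn(σ) (k+2)^{c(σ)} ∏ x_{σ(i),i}` (coefficient written as the colouring count
`#{f : [n] → [k+2] | f ∘ σ = f}`) is in `VP` for some `k`, then the crux `ClassTransfer` is false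
(`not_qpRealisable_colourFix` at the class function `sgn · (k+2)^{c}`). [folklore] -/
theorem not_classTransfer_of_isVPFamily_fermionant (k : ℕ)
    (hVP : Literature.Computability.AlgebraicComplexity.IsVPFamily
      (fun n => ∑ σ : Equiv.Perm (Fin n),
        MvPolynomial.C (((Equiv.Perm.sign σ : ℤ) : ℂ) *
            ((univ.filter fun f : Fin n → Fin (k + 2) => ∀ x, f (σ x) = f x).card : ℂ)) *
          ∏ i : Fin n, MvPolynomial.X (σ i, i))) :
    ¬ Summit.ValiantsHypothesis.ValiantsHypothesis.Theses.FermionizationDimension.ClassTransfer :=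
  fun hCT => not_qpRealisable_colourFix k (hCT
    (fun n σ => ((Equiv.Perm.sign σ : ℤ) : ℂ) *
      ((univ.filter fun f : Fin n → Fin (k + 2) => ∀ x, f (σ x) = f x).card : ℂ))
    (colourFix_isClassFunction k) hVP)

/-- **The crux decides the fermionants**: `ClassTransfer` implies that NO fermionant family
`Fer_k = Σ_σ sgn(σ) k^{c(σ)} x^σ` with `k ≥ 2` colours is in `VP_ℂ` — in particular
`Fer_2 = (-1)^n per_{-2} ∉ VP`, whose algebraic complexity is open (MertensMoore2013: `⊕P`-hard
under randomized Turing reductions).  The sharpest recorded test of the crux. [folklore] -/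
theorem not_isVPFamily_fermionant_of_classTransfer
    (hCT : Summit.ValiantsHypothesis.ValiantsHypothesis.Theses.FermionizationDimension.ClassTransfer)
    (k : ℕ) :
    ¬ Literature.Computability.AlgebraicComplexity.IsVPFamily
      (fun n => ∑ σ : Equiv.Perm (Fin n),
        MvPolynomial.C (((Equiv.Perm.sign σ : ℤ) : ℂ) *
            ((univ.filter fun f : Fin n → Fin (k + 2) => ∀ x, f (σ x) = f x).card : ℂ)) *
          ∏ i : Fin n, MvPolynomial.X (σ i, i)) :=
  fun hVP => not_classTransfer_of_isVPFamily_fermionant k hVP hCT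

end Summit.ValiantsHypothesis.ValiantsHypothesis.Theorems.ClassTransfer.Negative
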